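import Mathlib
import HarnessLib
import Summits.Ventures.LatticeQCDFlow.Exactness.SphereTimeDependentFlow
import Summits.Ventures.LatticeQCDFlow.Exactness.SphereFlowTransportCovariance

/-!
# Lüscher's trivialization theorem on the lattice of site spheres: if the generator `G_t` solves `𝓛_tG_t = S + C_t` on `[0, c]`, the time-dependent flow `Φ_{0→c}` pushes `π̄` forward to `e^{−cS}π̄/Z_c`; and for the truncated series `Σ_{k≤K}t^kS̃⁽ᵏ⁾` the transported law departs from the tilted family at the rate `s^{K+1}·Cov_s(H∘Φ_{s→c}, Σ⟨∂̃S, ∂̃S̃⁽ᴷ⁾⟩)`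

HONEST FRAMING: exact (Metropolis-corrected) sampling algorithms for lattice gauge theory;
figures of merit are autocorrelation/cost numbers at stated couplings and volumes; no
continuum-physics claim.

Venture `LatticeQCDFlow` (cell pub-lqcd), topic `Exactness`; FANOUT row 7 (`s0-cpn-null`: the
S0-D1 rung — 2D CP⁹, Lüscher's trivializing map inside HMC, Engel–Schaefer 2011).  NEW WORK of the
cell over the tree's `Exactness/SphereTimeDependentFlow.lean` (this leg: the evolution maps
`Φ_{t₀→t}` of `ẋ = −∂̃G_t(x)`, their pull-back derivative), `Exactness/SphereFlowTransport.lean` and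
`Exactness/SphereFlowTransportCovariance.lean` (this leg: the transport identity, the covariance
law and the constant-residual criterion for an ABSTRACT pull-back family),
`Exactness/SphereLuscherNormalization.lean` (GEN-12: the truncated series solves the flow equation
up to `t^{K+1}Σ⟨∂̃S, ∂̃S̃⁽ᴷ⁾⟩`) and `Exactness/SphereLuscherFiniteTimeUniqueness.lean` (linearity of
`𝓛_t`); nothing is cited as a fact.  Printed counterpart, NAMED ONLY: M. Lüscher, "Trivializing
maps, the Wilson flow and the HMC algorithm", Commun. Math. Phys. 293 (2010) 899, §3 eqs.
(3.4)–(3.9) and §4.2 eqs. (4.5)–(4.9): THE FLOW GENERATED BY A SOLUTION OF `𝓛_tS̃_t = S + Ċ_t`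
TRIVIALIZES `e^{−tS}`; §4.3 (truncations).  Lüscher's proof differentiates `ln det` of the
Jacobian; here the observable is transported instead (no Jacobians), for the lattice of site
spheres `Ω = S(E)^Λ` and every jointly `C²` generator family `G : ℝ → (Λ → E) → ℝ`:

* §1 **THE TIME-DEPENDENT TRANSPORT IDENTITY AND COVARIANCE LAW**
  (**`hasDerivAt_integral_exp_mul_comp_sphereTDFlow`**, **`hasDerivAt_tiltedMean_comp_sphereTDFlow`**):
  with `Φ = sphereTDFlow hG T` and `|s₀| ≤ |T| + 1`,
  `(d/ds)|_{s₀}∫e^{−sS}H(Φ_{s→c}ω)dπ̄ = ∫e^{−s₀S}H(Φ_{s₀→c}ω)(𝓛_{s₀}G_{s₀} − S)(ω)dπ̄` and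
  `(d/ds)|_{s₀}⟨H∘Φ_{s→c}⟩_s = ⟨(H∘Φ_{s₀→c})R⟩_{s₀} − ⟨H∘Φ_{s₀→c}⟩_{s₀}⟨R⟩_{s₀}`, `R = 𝓛_{s₀}G_{s₀} − S`
  (`S, H ∈ C¹`; the abstract family theorems applied to `Ψ_s = Φ_{s→c}` with the effective generator
  `ψ_T(s)G_s`, which is `G_s` in the window);
* §2 **LÜSCHER'S THEOREM** (**`luscher_trivialization`**, **`luscher_trivialization_tilted`**): if
  `𝓛_sG_s = S + C_s` on `Ω` for every `s ∈ [0, c]` (`c ≥ 0`), then for every `C¹` observable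
  `∫ H(Φ_{0→c}ω) dπ̄(ω) = ∫e^{−cS}H dπ̄ / ∫e^{−cS}dπ̄ = ∫ H d(π̄.tilted(−cS))` with `Φ = sphereTDFlow hG c`:
  THE EVOLUTION MAP FROM TIME `0` TO TIME `c` OF LÜSCHER'S FLOW PUSHES THE A-PRIORI MEASURE FORWARD
  TO THE TILTED MEASURE `e^{−cS}π̄/Z_c` (weak form, `C¹` test functionals);
* §3 **THE TRUNCATED SERIES** (**`hasDerivAt_tiltedMean_comp_sphereTDFlow_partialSum`**): for a `C²`
  Lüscher series `(S̃⁽ᵏ⁾, ċ_k)` of `S` (the recursion `−Σ∂̃²S̃⁽⁰⁾ = S + ċ₀`,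
  `−Σ∂̃²S̃⁽ᵏ⁺¹⁾ = −Σ⟨∂̃S, ∂̃S̃⁽ᵏ⁾⟩ + ċ_{k+1}`) and the flow `Φ` of `G_t = Σ_{k≤K}t^kS̃⁽ᵏ⁾`,
  `(d/ds)|_{s₀}⟨H∘Φ_{s→c}⟩_s = s₀^{K+1}·(⟨(H∘Φ_{s₀→c})V_K⟩_{s₀} − ⟨H∘Φ_{s₀→c}⟩_{s₀}⟨V_K⟩_{s₀})`,
  `V_K = Σ_n⟨∂̃_nS, ∂̃_nS̃⁽ᴷ⁾⟩` — THE ORDER-`K` TRUNCATION IS TRIVIALIZING TO ORDER `K + 1`: the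
  transported law departs from the tilted family at rate `O(s^{K+1})`, the constants `Σċ_ks^k`
  dropping out of the covariance exactly.

NOT CLAIMED: existence of an exact solution family `G_t` of `𝓛_tG_t = S + C_t` jointly `C²` in
`(t, x)` (Lüscher's Prop. 3.1–3.2 / App. E: the finite-`t` inverse of `𝓛_t` — the tree has
uniqueness and the spectral gap, GEN-12, not existence); convergence of the series; equality of
measures beyond the weak form with `C¹` test functionals; the Jacobian of `Φ`; a quantitative bound
for the order-`K` defect (the LO case `K = 0` with the autonomous flow is
`Exactness/SphereLOMapSecondOrder.lean`); anything about autocorrelations or the rung's numbers.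
-/

noncomputable section

namespace Summit.Ventures.LatticeQCDFlow.Exactness

open Function Set Metric MeasureTheory NormedSpace InnerProductSpace
open scoped RealInnerProductSpace Topology

variable {Λ : Type*} {E : Type*} [NormedAddCommGroup E] [InnerProductSpace ℝ E]
  [FiniteDimensional ℝ E] [Fintype Λ] [DecidableEq Λ]

/-! ## §1 The transport identity and the covariance law for the time-dependent flow -/

section Transport

variable {G : ℝ → (Λ → E) → ℝ} {T : ℝ}

omit [FiniteDimensional ℝ E] [DecidableEq Λ] in
/-- The effective generator `ψ_T(s)·G_s` is `C²`. -/
theorem contDiff_timeBump_mul (hG : ContDiff ℝ 2 fun q : ℝ × (Λ → E) => G q.1 q.2) (s : ℝ) :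
    ContDiff ℝ 2 fun z : Λ → E => (timeBump T : ℝ → ℝ) s * G s z :=
  contDiff_const.mul (contDiff_of_joint hG s)

/-- On `Ω`, `∂̃_n(ψ_T(s)·G_s) = ψ_T(s)·∂̃_nG_s`. -/
theorem siteGrad_timeBump_mul (hG : ContDiff ℝ 2 fun q : ℝ × (Λ → E) => G q.1 q.2) (s : ℝ)
    (ω : Λ → sphere (0 : E) 1) (n : Λ) :
    siteGrad n (fun z : Λ → E => (timeBump T : ℝ → ℝ) s * G s z) (fun m => (ω m : E)) =
      (timeBump T : ℝ → ℝ) s • siteGrad n (G s) (fun m => (ω m : E)) :=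
  siteGrad_const_mul (x := fun m => (ω m : E)) (sphereConfig_ne_zero ω n)
    (contDiff_comp_update ((contDiff_of_joint hG s).of_le (by norm_num)) _ n) _

/-- `(s, ω) ↦ ∂̃_n(ψ_T(s)·G_s)(ω)` is jointly continuous on `ℝ × Ω`. -/
theorem continuous_siteGrad_timeBump_mul (hG : ContDiff ℝ 2 fun q : ℝ × (Λ → E) => G q.1 q.2)
    (n : Λ) :
    Continuous fun p : ℝ × (Λ → sphere (0 : E) 1) =>
      siteGrad n (fun z : Λ → E => (timeBump T : ℝ → ℝ) p.1 * G p.1 z) (fun m => (p.2 m : E)) := by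
  have e : (fun p : ℝ × (Λ → sphere (0 : E) 1) =>
      siteGrad n (fun z : Λ → E => (timeBump T : ℝ → ℝ) p.1 * G p.1 z) (fun m => (p.2 m : E))) =
      fun p => (timeBump T : ℝ → ℝ) p.1 • siteGrad n (G p.1) (fun m => (p.2 m : E)) := by
    funext p; exact siteGrad_timeBump_mul hG p.1 p.2 n
  rw [e]
  have hψ : Continuous fun p : ℝ × (Λ → sphere (0 : E) 1) => (timeBump T : ℝ → ℝ) p.1 :=
    (timeBump T).continuous.comp continuous_fst
  have hgrad : Continuous fun p : ℝ × (Λ → sphere (0 : E) 1) =>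
      siteGrad n (G p.1) (fun m => (p.2 m : E)) := by
    refine continuous_iff_continuousAt.2 fun p => ?_
    have h := (contDiffAt_siteGrad_param hG n (q := (p.1, fun m => (p.2 m : E)))
      (sphereConfig_ne_zero p.2 n)).continuousAt
    have h2 : ContinuousAt ((fun q' : ℝ × (Λ → E) => siteGrad n (G q'.1) q'.2) ∘
        fun p' : ℝ × (Λ → sphere (0 : E) 1) => ((p'.1, fun m => (p'.2 m : E)) : ℝ × (Λ → E))) p :=
      ContinuousAt.comp_of_eq h
        (continuous_fst.prodMk (continuous_sphereConfig.comp continuous_snd)).continuousAt rfl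
    exact h2
  exact hψ.smul hgrad

/-- On `Ω` and in the window, `𝓛_s(ψ_T(s)G_s) = 𝓛_sG_s`. -/
theorem sphereLuscherL_timeBump_mul {S : (Λ → E) → ℝ}
    (hG : ContDiff ℝ 2 fun q : ℝ × (Λ → E) => G q.1 q.2) {s : ℝ} (hs : |s| ≤ |T| + 1)
    (ω : Λ → sphere (0 : E) 1) :
    sphereLuscherL S s (fun z : Λ → E => (timeBump T : ℝ → ℝ) s * G s z) (fun m => (ω m : E)) =
      sphereLuscherL S s (G s) (fun m => (ω m : E)) := by
  rw [sphereLuscherL_const_mul s (contDiff_of_joint hG s) _ ω, timeBump_eq_one hs, one_mul]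

variable [MeasurableSpace E] [BorelSpace E] [Nontrivial E]

/-- **THE TIME-DEPENDENT TRANSPORT IDENTITY** (effective-generator form, every real `s₀`):
`(d/ds)|_{s₀}∫e^{−sS}H(Φ_{s→c}ω)dπ̄ = ∫e^{−s₀S}H(Φ_{s₀→c}ω)·(𝓛_{s₀}(ψ_T(s₀)G_{s₀}) − S)(ω)dπ̄`. -/
theorem hasDerivAt_integral_exp_mul_comp_sphereTDFlow_bump {S H : (Λ → E) → ℝ}
    (hS : ContDiff ℝ 1 S) (hG : ContDiff ℝ 2 fun q : ℝ × (Λ → E) => G q.1 q.2)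
    (hH : ContDiff ℝ 1 H) (c s₀ : ℝ) :
    HasDerivAt (fun s => ∫ ω, Real.exp (-(s * S (fun m => ((ω : Λ → sphere (0 : E) 1) m : E)))) *
        H (sphereTDFlow hG T s c (fun m => (ω m : E)))
          ∂Measure.pi (fun _ : Λ => uniformSphere (volume : Measure E)))
      (∫ ω, Real.exp (-(s₀ * S (fun m => ((ω : Λ → sphere (0 : E) 1) m : E)))) *
          H (sphereTDFlow hG T s₀ c (fun m => (ω m : E))) *
            (sphereLuscherL S s₀ (fun z : Λ → E => (timeBump T : ℝ → ℝ) s₀ * G s₀ z)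
              (fun m => (ω m : E)) - S (fun m => (ω m : E)))
        ∂Measure.pi (fun _ : Λ => uniformSphere (volume : Measure E))) s₀ :=
  hasDerivAt_integral_exp_mul_comp_family (Ψ := fun s z => sphereTDFlow hG T s c z)
    (Gs := fun s z => (timeBump T : ℝ → ℝ) s * G s z) hS hH (contDiff_sphereTDFlow_initial hG c)
    (contDiff_timeBump_mul hG) (continuous_siteGrad_timeBump_mul hG)
    (fun s ω => hasDerivAt_comp_sphereTDFlow_initial' hG (hH.differentiable one_ne_zero)
      (norm_sphereConfig_eq_one ω) c s) s₀

/-- **THE TIME-DEPENDENT TRANSPORT IDENTITY IN THE WINDOW** `|s₀| ≤ |T| + 1`: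
`(d/ds)|_{s₀}∫e^{−sS}H(Φ_{s→c}ω)dπ̄ = ∫e^{−s₀S}H(Φ_{s₀→c}ω)·(𝓛_{s₀}G_{s₀} − S)(ω)dπ̄`. -/
theorem hasDerivAt_integral_exp_mul_comp_sphereTDFlow {S H : (Λ → E) → ℝ} (hS : ContDiff ℝ 1 S)
    (hG : ContDiff ℝ 2 fun q : ℝ × (Λ → E) => G q.1 q.2) (hH : ContDiff ℝ 1 H) (c : ℝ) {s₀ : ℝ}
    (hs₀ : |s₀| ≤ |T| + 1) :
    HasDerivAt (fun s => ∫ ω, Real.exp (-(s * S (fun m => ((ω : Λ → sphere (0 : E) 1) m : E)))) *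
        H (sphereTDFlow hG T s c (fun m => (ω m : E)))
          ∂Measure.pi (fun _ : Λ => uniformSphere (volume : Measure E)))
      (∫ ω, Real.exp (-(s₀ * S (fun m => ((ω : Λ → sphere (0 : E) 1) m : E)))) *
          H (sphereTDFlow hG T s₀ c (fun m => (ω m : E))) *
            (sphereLuscherL S s₀ (G s₀) (fun m => (ω m : E)) - S (fun m => (ω m : E)))
        ∂Measure.pi (fun _ : Λ => uniformSphere (volume : Measure E))) s₀ := by
  have h := hasDerivAt_integral_exp_mul_comp_sphereTDFlow_bump hS hG hH c s₀ (T := T)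
  simp_rw [sphereLuscherL_timeBump_mul hG hs₀] at h
  exact h

/-- **THE TIME-DEPENDENT COVARIANCE LAW IN THE WINDOW**: for `|s₀| ≤ |T| + 1`,
`(d/ds)|_{s₀}⟨H∘Φ_{s→c}⟩_s = ⟨(H∘Φ_{s₀→c})·R⟩_{s₀} − ⟨H∘Φ_{s₀→c}⟩_{s₀}·⟨R⟩_{s₀}`, `R = 𝓛_{s₀}G_{s₀} − S`. -/
theorem hasDerivAt_tiltedMean_comp_sphereTDFlow {S H : (Λ → E) → ℝ} (hS : ContDiff ℝ 1 S)
    (hG : ContDiff ℝ 2 fun q : ℝ × (Λ → E) => G q.1 q.2) (hH : ContDiff ℝ 1 H) (c : ℝ) {s₀ : ℝ}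
    (hs₀ : |s₀| ≤ |T| + 1) :
    HasDerivAt (fun s =>
        (∫ ω, Real.exp (-(s * S (fun m => ((ω : Λ → sphere (0 : E) 1) m : E)))) *
            H (sphereTDFlow hG T s c (fun m => (ω m : E)))
              ∂Measure.pi (fun _ : Λ => uniformSphere (volume : Measure E))) /
          ∫ ω, Real.exp (-(s * S (fun m => ((ω : Λ → sphere (0 : E) 1) m : E))))
            ∂Measure.pi (fun _ : Λ => uniformSphere (volume : Measure E)))
      ((∫ ω, Real.exp (-(s₀ * S (fun m => ((ω : Λ → sphere (0 : E) 1) m : E)))) *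
            H (sphereTDFlow hG T s₀ c (fun m => (ω m : E))) *
              (sphereLuscherL S s₀ (G s₀) (fun m => (ω m : E)) - S (fun m => (ω m : E)))
          ∂Measure.pi (fun _ : Λ => uniformSphere (volume : Measure E))) /
          (∫ ω, Real.exp (-(s₀ * S (fun m => ((ω : Λ → sphere (0 : E) 1) m : E))))
            ∂Measure.pi (fun _ : Λ => uniformSphere (volume : Measure E))) -
        (∫ ω, Real.exp (-(s₀ * S (fun m => ((ω : Λ → sphere (0 : E) 1) m : E)))) *
            H (sphereTDFlow hG T s₀ c (fun m => (ω m : E)))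
          ∂Measure.pi (fun _ : Λ => uniformSphere (volume : Measure E))) /
          (∫ ω, Real.exp (-(s₀ * S (fun m => ((ω : Λ → sphere (0 : E) 1) m : E))))
            ∂Measure.pi (fun _ : Λ => uniformSphere (volume : Measure E))) *
        ((∫ ω, Real.exp (-(s₀ * S (fun m => ((ω : Λ → sphere (0 : E) 1) m : E)))) *
              (sphereLuscherL S s₀ (G s₀) (fun m => (ω m : E)) - S (fun m => (ω m : E)))
            ∂Measure.pi (fun _ : Λ => uniformSphere (volume : Measure E))) /
          ∫ ω, Real.exp (-(s₀ * S (fun m => ((ω : Λ → sphere (0 : E) 1) m : E))))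
            ∂Measure.pi (fun _ : Λ => uniformSphere (volume : Measure E)))) s₀ := by
  have h := hasDerivAt_tiltedMean_comp_family (Ψ := fun s z => sphereTDFlow hG T s c z)
    (Gs := fun s z => (timeBump T : ℝ → ℝ) s * G s z) hS hH (contDiff_sphereTDFlow_initial hG c)
    (contDiff_timeBump_mul hG) (continuous_siteGrad_timeBump_mul hG)
    (fun s ω => hasDerivAt_comp_sphereTDFlow_initial' hG (hH.differentiable one_ne_zero)
      (norm_sphereConfig_eq_one ω) c s) s₀
  simp_rw [sphereLuscherL_timeBump_mul hG hs₀] at h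
  exact h

end Transport

/-! ## §2 Lüscher's theorem -/

section Luscher

variable [MeasurableSpace E] [BorelSpace E] [Nontrivial E] {G : ℝ → (Λ → E) → ℝ}

/-- **LÜSCHER'S TRIVIALIZATION THEOREM ON THE LATTICE OF SITE SPHERES.**  Let `S ∈ C¹`, let
`G : ℝ → (Λ → E) → ℝ` be jointly `C²`, `0 ≤ c`, and let `Φ = sphereTDFlow hG c` be the evolution
maps of Lüscher's flow `ẋ_n = −∂̃_nG_t(x)` (exact on `[0, c]`).  IF `G_s` SOLVES THE FLOW EQUATION
`𝓛_sG_s = S + C_s` ON `Ω` FOR EVERY `s ∈ [0, c]`, THEN for every `C¹` observable `H`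
`∫ H(Φ_{0→c} ω) dπ̄(ω) = ∫ e^{−cS}H dπ̄ / ∫ e^{−cS} dπ̄`:
the map `Φ_{0→c}` pushes the a-priori product measure forward to the tilted measure `e^{−cS}π̄/Z_c`
— it trivializes `e^{−cS}` (weak form, `C¹` test functionals).  Proved by transporting the
observable: `s ↦ ⟨H∘Φ_{s→c}⟩_s` is constant on `[0, c]` (no Jacobians). -/
theorem luscher_trivialization {S H : (Λ → E) → ℝ} (hS : ContDiff ℝ 1 S)
    (hG : ContDiff ℝ 2 fun q : ℝ × (Λ → E) => G q.1 q.2) (hH : ContDiff ℝ 1 H) {c : ℝ} (hc : 0 ≤ c)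
    {C : ℝ → ℝ}
    (hsol : ∀ s ∈ Icc 0 c, ∀ ω : Λ → sphere (0 : E) 1,
      sphereLuscherL S s (G s) (fun m => (ω m : E)) = S (fun m => (ω m : E)) + C s) :
    ∫ ω, H (sphereTDFlow hG c 0 c (fun m => ((ω : Λ → sphere (0 : E) 1) m : E)))
        ∂Measure.pi (fun _ : Λ => uniformSphere (volume : Measure E)) =
      (∫ ω, Real.exp (-(c * S (fun m => ((ω : Λ → sphere (0 : E) 1) m : E)))) * H (fun m => (ω m : E))
          ∂Measure.pi (fun _ : Λ => uniformSphere (volume : Measure E))) /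
        ∫ ω, Real.exp (-(c * S (fun m => ((ω : Λ → sphere (0 : E) 1) m : E))))
          ∂Measure.pi (fun _ : Λ => uniformSphere (volume : Measure E)) := by
  have hsol' : ∀ s ∈ Icc 0 c, ∀ ω : Λ → sphere (0 : E) 1,
      sphereLuscherL S s (fun z : Λ → E => (timeBump c : ℝ → ℝ) s * G s z) (fun m => (ω m : E)) =
        S (fun m => (ω m : E)) + C s := fun s hs ω => by
    have hs' : |s| ≤ |c| + 1 := by
      rw [abs_of_nonneg hs.1, abs_of_nonneg hc]; linarith [hs.2]
    rw [sphereLuscherL_timeBump_mul hG hs' ω, hsol s hs ω]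
  have h := tiltedMean_comp_family_eq_of_residual_const (Ψ := fun s z => sphereTDFlow hG c s c z)
    (Gs := fun s z => (timeBump c : ℝ → ℝ) s * G s z) hS hH (contDiff_sphereTDFlow_initial hG c)
    (contDiff_timeBump_mul hG) (continuous_siteGrad_timeBump_mul hG)
    (fun s ω => hasDerivAt_comp_sphereTDFlow_initial' hG (hH.differentiable one_ne_zero)
      (norm_sphereConfig_eq_one ω) c s) hsol' (s := c) ⟨hc, le_rfl⟩
  simp only [sphereTDFlow_self, zero_mul, neg_zero, Real.exp_zero, one_mul, integral_const,
    smul_eq_mul, mul_one, probReal_univ, div_one] at h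
  exact h.symm

/-- **Lüscher's theorem in tilted-measure form**: under the same hypotheses,
`∫ H∘Φ_{0→c} dπ̄ = ∫ H d(π̄.tilted(−cS))` for every `C¹` observable. -/
theorem luscher_trivialization_tilted {S H : (Λ → E) → ℝ} (hS : ContDiff ℝ 1 S)
    (hG : ContDiff ℝ 2 fun q : ℝ × (Λ → E) => G q.1 q.2) (hH : ContDiff ℝ 1 H) {c : ℝ} (hc : 0 ≤ c)
    {C : ℝ → ℝ}
    (hsol : ∀ s ∈ Icc 0 c, ∀ ω : Λ → sphere (0 : E) 1,
      sphereLuscherL S s (G s) (fun m => (ω m : E)) = S (fun m => (ω m : E)) + C s) :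
    ∫ ω, H (sphereTDFlow hG c 0 c (fun m => ((ω : Λ → sphere (0 : E) 1) m : E)))
        ∂Measure.pi (fun _ : Λ => uniformSphere (volume : Measure E)) =
      ∫ ω, H (fun m => ((ω : Λ → sphere (0 : E) 1) m : E))
        ∂(Measure.pi (fun _ : Λ => uniformSphere (volume : Measure E))).tilted
          (fun ω => -(c * S (fun m => (ω m : E)))) := by
  rw [integral_tilted_neg_action, luscher_trivialization hS hG hH hc hsol]

end Luscher

/-! ## §3 The truncated series: trivializing to order `K + 1` -/

section Truncated

variable [MeasurableSpace E] [BorelSpace E] [Nontrivial E]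
variable {S : (Λ → E) → ℝ} {St : ℕ → (Λ → E) → ℝ} {c : ℕ → ℝ}

omit [FiniteDimensional ℝ E] [DecidableEq Λ] [MeasurableSpace E] [BorelSpace E] [Nontrivial E] in
/-- The truncated Lüscher series `G_t = Σ_{k≤K} t^kS̃⁽ᵏ⁾` is jointly `C²` in `(t, x)` when every
`S̃⁽ᵏ⁾ ∈ C²`. -/
theorem contDiff_partialSum_joint (hSt : ∀ k, ContDiff ℝ 2 (St k)) (K : ℕ) :
    ContDiff ℝ 2 fun q : ℝ × (Λ → E) => ∑ k ∈ Finset.range (K + 1), q.1 ^ k * St k q.2 :=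
  ContDiff.sum fun k _ => (contDiff_fst.pow k).mul ((hSt k).comp contDiff_snd)

/-- **THE ORDER-`K` TRUNCATION IS TRIVIALIZING TO ORDER `K + 1`.**  For a `C¹` action `S`, a `C²`
Lüscher series `(S̃⁽ᵏ⁾, ċ_k)` of `S`, the flow `Φ = sphereTDFlow _ T` of `G_t = Σ_{k≤K}t^kS̃⁽ᵏ⁾`,
a `C¹` observable `H`, and `|s₀| ≤ |T| + 1`:
`(d/ds)|_{s₀}⟨H∘Φ_{s→c}⟩_s = s₀^{K+1}·(⟨(H∘Φ_{s₀→c})·V_K⟩_{s₀} − ⟨H∘Φ_{s₀→c}⟩_{s₀}·⟨V_K⟩_{s₀})`,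
`V_K = Σ_n⟨∂̃_nS, ∂̃_nS̃⁽ᴷ⁾⟩` — the constants `Σ_{k≤K}ċ_ks^k` of the residual drop out of the
covariance and only the `s^{K+1}` cross term moves the transported law off the tilted family. -/
theorem hasDerivAt_tiltedMean_comp_sphereTDFlow_partialSum (hS : ContDiff ℝ 1 S)
    (hSt : ∀ k, ContDiff ℝ 2 (St k))
    (h0 : ∀ ξ : Λ → sphere (0 : E) 1,
      -∑ n, siteLaplacian n (St 0) (fun m => (ξ m : E)) = S (fun m => (ξ m : E)) + c 0)
    (hs : ∀ k, ∀ ξ : Λ → sphere (0 : E) 1,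
      -∑ n, siteLaplacian n (St (k + 1)) (fun m => (ξ m : E)) =
        -(∑ n, ⟪siteGrad n S (fun m => (ξ m : E)), siteGrad n (St k) (fun m => (ξ m : E))⟫) +
          c (k + 1))
    (K : ℕ) {H : (Λ → E) → ℝ} (hH : ContDiff ℝ 1 H) (T cf : ℝ) {s₀ : ℝ} (hs₀ : |s₀| ≤ |T| + 1) :
    HasDerivAt (fun s =>
        (∫ ω, Real.exp (-(s * S (fun m => ((ω : Λ → sphere (0 : E) 1) m : E)))) *
            H (sphereTDFlow (G := fun t z => ∑ k ∈ Finset.range (K + 1), t ^ k * St k z)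
              (contDiff_partialSum_joint hSt K) T s cf (fun m => (ω m : E)))
              ∂Measure.pi (fun _ : Λ => uniformSphere (volume : Measure E))) /
          ∫ ω, Real.exp (-(s * S (fun m => ((ω : Λ → sphere (0 : E) 1) m : E))))
            ∂Measure.pi (fun _ : Λ => uniformSphere (volume : Measure E)))
      (s₀ ^ (K + 1) *
        ((∫ ω, Real.exp (-(s₀ * S (fun m => ((ω : Λ → sphere (0 : E) 1) m : E)))) *
              H (sphereTDFlow (G := fun t z => ∑ k ∈ Finset.range (K + 1), t ^ k * St k z)
              (contDiff_partialSum_joint hSt K) T s₀ cf (fun m => (ω m : E))) *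
                ∑ n, ⟪siteGrad n S (fun m => (ω m : E)), siteGrad n (St K) (fun m => (ω m : E))⟫
            ∂Measure.pi (fun _ : Λ => uniformSphere (volume : Measure E))) /
            (∫ ω, Real.exp (-(s₀ * S (fun m => ((ω : Λ → sphere (0 : E) 1) m : E))))
              ∂Measure.pi (fun _ : Λ => uniformSphere (volume : Measure E))) -
          (∫ ω, Real.exp (-(s₀ * S (fun m => ((ω : Λ → sphere (0 : E) 1) m : E)))) *
              H (sphereTDFlow (G := fun t z => ∑ k ∈ Finset.range (K + 1), t ^ k * St k z)
              (contDiff_partialSum_joint hSt K) T s₀ cf (fun m => (ω m : E)))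
            ∂Measure.pi (fun _ : Λ => uniformSphere (volume : Measure E))) /
            (∫ ω, Real.exp (-(s₀ * S (fun m => ((ω : Λ → sphere (0 : E) 1) m : E))))
              ∂Measure.pi (fun _ : Λ => uniformSphere (volume : Measure E))) *
          ((∫ ω, Real.exp (-(s₀ * S (fun m => ((ω : Λ → sphere (0 : E) 1) m : E)))) *
                ∑ n, ⟪siteGrad n S (fun m => (ω m : E)), siteGrad n (St K) (fun m => (ω m : E))⟫
              ∂Measure.pi (fun _ : Λ => uniformSphere (volume : Measure E))) /
            ∫ ω, Real.exp (-(s₀ * S (fun m => ((ω : Λ → sphere (0 : E) 1) m : E))))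
              ∂Measure.pi (fun _ : Λ => uniformSphere (volume : Measure E))))) s₀ := by
  have hG := contDiff_partialSum_joint (Λ := Λ) hSt K
  have h := hasDerivAt_tiltedMean_comp_sphereTDFlow
    (G := fun t z => ∑ k ∈ Finset.range (K + 1), t ^ k * St k z) hS hG hH cf hs₀ (T := T)
  refine h.congr_deriv ?_
  have hZ := integral_exp_neg_mul_pos (Λ := Λ) (E := E) hS.continuous s₀
  -- the residual of the truncated series: constants plus `s₀^{K+1}·V_K`
  have hres : ∀ ω : Λ → sphere (0 : E) 1,
      sphereLuscherL S s₀ (fun z : Λ → E => ∑ k ∈ Finset.range (K + 1), s₀ ^ k * St k z)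
          (fun m => (ω m : E)) - S (fun m => (ω m : E)) =
        (∑ k ∈ Finset.range (K + 1), c k * s₀ ^ k) +
          s₀ ^ (K + 1) * ∑ n, ⟪siteGrad n S (fun m => (ω m : E)), siteGrad n (St K) (fun m => (ω m : E))⟫ :=
    fun ω => by rw [sphereLuscherL_partialSum hSt h0 hs s₀ K ω]; ring
  simp_rw [hres]
  -- continuity / integrability
  have hcW := continuous_exp_neg_mul_sphereConfig (Λ := Λ) hS.continuous s₀
  have hcK : Continuous fun ω : Λ → sphere (0 : E) 1 =>
      H (sphereTDFlow (G := fun t z => ∑ k ∈ Finset.range (K + 1), t ^ k * St k z) hG T s₀ cf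
        (fun m => (ω m : E))) :=
    (hH.continuous.comp (contDiff_sphereTDFlow_apply hG s₀ cf).continuous).comp
      continuous_sphereConfig
  have hcV : Continuous fun ω : Λ → sphere (0 : E) 1 =>
      ∑ n, ⟪siteGrad n S (fun m => (ω m : E)), siteGrad n (St K) (fun m => (ω m : E))⟫ :=
    continuous_finsetSum _ fun n _ => continuous_inner_siteGrad ((hSt K).of_le (by norm_num)) hS n n
  have hiK : Integrable (fun ω : Λ → sphere (0 : E) 1 =>
      Real.exp (-(s₀ * S (fun m => (ω m : E)))) * H (sphereTDFlow (G := fun t z => ∑ k ∈ Finset.range (K + 1), t ^ k * St k z) hG T s₀ cf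
        (fun m => (ω m : E))))
      (Measure.pi fun _ : Λ => uniformSphere (volume : Measure E)) :=
    integrable_pi_of_continuous _ (hcW.mul hcK)
  have hiKV : Integrable (fun ω : Λ → sphere (0 : E) 1 =>
      Real.exp (-(s₀ * S (fun m => (ω m : E)))) * H (sphereTDFlow (G := fun t z => ∑ k ∈ Finset.range (K + 1), t ^ k * St k z) hG T s₀ cf
        (fun m => (ω m : E))) *
        ∑ n, ⟪siteGrad n S (fun m => (ω m : E)), siteGrad n (St K) (fun m => (ω m : E))⟫)
      (Measure.pi fun _ : Λ => uniformSphere (volume : Measure E)) :=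
    integrable_pi_of_continuous _ ((hcW.mul hcK).mul hcV)
  have hiV : Integrable (fun ω : Λ → sphere (0 : E) 1 =>
      Real.exp (-(s₀ * S (fun m => (ω m : E)))) *
        ∑ n, ⟪siteGrad n S (fun m => (ω m : E)), siteGrad n (St K) (fun m => (ω m : E))⟫)
      (Measure.pi fun _ : Λ => uniformSphere (volume : Measure E)) :=
    integrable_pi_of_continuous _ (hcW.mul hcV)
  have hiW : Integrable (fun ω : Λ → sphere (0 : E) 1 => Real.exp (-(s₀ * S (fun m => (ω m : E)))))
      (Measure.pi fun _ : Λ => uniformSphere (volume : Measure E)) :=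
    integrable_pi_of_continuous _ hcW
  set A₀ : ℝ := ∑ k ∈ Finset.range (K + 1), c k * s₀ ^ k with hA₀
  have hKR : ∫ ω, Real.exp (-(s₀ * S (fun m => ((ω : Λ → sphere (0 : E) 1) m : E)))) *
        H (sphereTDFlow (G := fun t z => ∑ k ∈ Finset.range (K + 1), t ^ k * St k z) hG T s₀ cf
        (fun m => (ω m : E))) *
          (A₀ + s₀ ^ (K + 1) *
            ∑ n, ⟪siteGrad n S (fun m => (ω m : E)), siteGrad n (St K) (fun m => (ω m : E))⟫)
        ∂Measure.pi (fun _ : Λ => uniformSphere (volume : Measure E)) =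
      A₀ * (∫ ω, Real.exp (-(s₀ * S (fun m => ((ω : Λ → sphere (0 : E) 1) m : E)))) *
          H (sphereTDFlow (G := fun t z => ∑ k ∈ Finset.range (K + 1), t ^ k * St k z) hG T s₀ cf
        (fun m => (ω m : E)))
            ∂Measure.pi (fun _ : Λ => uniformSphere (volume : Measure E))) +
        s₀ ^ (K + 1) * ∫ ω, Real.exp (-(s₀ * S (fun m => ((ω : Λ → sphere (0 : E) 1) m : E)))) *
          H (sphereTDFlow (G := fun t z => ∑ k ∈ Finset.range (K + 1), t ^ k * St k z) hG T s₀ cf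
        (fun m => (ω m : E))) *
            ∑ n, ⟪siteGrad n S (fun m => (ω m : E)), siteGrad n (St K) (fun m => (ω m : E))⟫
          ∂Measure.pi (fun _ : Λ => uniformSphere (volume : Measure E)) := by
    rw [← integral_const_mul, ← integral_const_mul, ← integral_add (hiK.const_mul _) (hiKV.const_mul _)]
    refine integral_congr_ae (ae_of_all _ fun ω => ?_)
    ring
  have hR : ∫ ω, Real.exp (-(s₀ * S (fun m => ((ω : Λ → sphere (0 : E) 1) m : E)))) *
        (A₀ + s₀ ^ (K + 1) *
          ∑ n, ⟪siteGrad n S (fun m => (ω m : E)), siteGrad n (St K) (fun m => (ω m : E))⟫)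
        ∂Measure.pi (fun _ : Λ => uniformSphere (volume : Measure E)) =
      A₀ * (∫ ω, Real.exp (-(s₀ * S (fun m => ((ω : Λ → sphere (0 : E) 1) m : E))))
          ∂Measure.pi (fun _ : Λ => uniformSphere (volume : Measure E))) +
        s₀ ^ (K + 1) * ∫ ω, Real.exp (-(s₀ * S (fun m => ((ω : Λ → sphere (0 : E) 1) m : E)))) *
          ∑ n, ⟪siteGrad n S (fun m => (ω m : E)), siteGrad n (St K) (fun m => (ω m : E))⟫
          ∂Measure.pi (fun _ : Λ => uniformSphere (volume : Measure E)) := by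
    rw [← integral_const_mul, ← integral_const_mul, ← integral_add (hiW.const_mul _) (hiV.const_mul _)]
    refine integral_congr_ae (ae_of_all _ fun ω => ?_)
    ring
  have key : ∀ A B V Z p : ℝ, Z ≠ 0 →
      (A₀ * A + p * B) / Z - A / Z * ((A₀ * Z + p * V) / Z) = p * (B / Z - A / Z * (V / Z)) := by
    intro A B V Z p hZ0
    field_simp
    ring
  rw [hKR, hR]
  exact key _ _ _ _ _ hZ.ne'

end Truncated

end Summit.Ventures.LatticeQCDFlow.Exactness

end
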